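import Literature.NumberTheory.LFunctions.MertensConjectureDisproofProofs
import Literature.NumberTheory.LFunctions.TuringMethod
import Literature.NumberTheory.LFunctions.ZetaArgVariation
import Literature.NumberTheory.LFunctions.RiemannSiegelStirling
import Literature.NumberTheory.LFunctions.LevinsonMontgomeryBacklund
import Literature.Analysis.Complex.WindingCertificate
import HarnessLib

/-!
# From certified values of `ζ` to the zero clause and the sums `h_K(y)` of Odlyzko–te Riele

Trunk T-ANT (NumberTheory/LFunctions). The *analytic glue* of the certified version of the
numerical part of Odlyzko–te Riele's disproof of the Mertens conjecture
(`Literature.NumberTheory.LFunctions.OdlyzkoTeRiele1985_numerics`, `MertensConjectureDisproof.lean`): theorems turning finitely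
many validated evaluations of `ζ` (produced elsewhere by the certified evaluator
`ZetaCertifiedEvaluation.lean` and checked by `native_decide`) into

1. zeros **on** the critical line in prescribed tiny intervals — the *twisted sign test*: if
   `Re (ζ(½+it₁) · conj ζ(½+it₂)) < 0` and `|θ(t₂) − θ(t₁)| < π/2` then `Z`, hence `ζ`, vanishes on
   `[t₁, t₂]` (`exists_zero_Icc_of_re_mul_conj_neg`; no evaluation of `θ` is needed, only the
   bound `|θ'| ≤ 10` below height `2²⁰`, `abs_riemannSiegelTheta_sub_le`);
2. the **exact zero count** `N(T)` from a winding certificate along the top edge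
   `[½, 2] × {T}` alone (`zetaZeroCount_eq_of_hpieces`): by Backlund's formula
   (`Literature.NumberTheory.LFunctions.pi_mul_zetaArgS_eq`) and the exact edge integral of `WindingCertificate.lean`, a certificate
   whose last label is `0` gives `N(T) = θ(T)/π + 1 + a/π − (turns)/2` with `|a| < π/2`, so that
   `N(T)` is the integer nearest to `θ(T)/π + 1 − turns/2`, and `θ(T)` is known from the explicit
   Stirling bound `Literature.NumberTheory.LFunctions.abs_riemannSiegelTheta_sub_stirling_le` (`zetaZeroCount_eq_of_hpieces_stirling`);
3. the **zero clause**: `N(T) = n` together with `n` distinct certified zeros on the line below `T`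
   forces every zero with `|Im ρ| < T` to be one of them (or a conjugate), on the line and simple
   (`zeros_below_of_count_eq_card`);
4. the **reduction of `h_K(y)`** (`Literature.NumberTheory.LFunctions.inghamSum`) to an explicit sum over the certified
   ordinates (`re_inghamSum_eq_sum_of_zeros`), and
5. an enclosure of **`ζ'(ρ)` from two values of `ζ`** on the line straddling `ρ`
   (`norm_deriv_riemannZeta_sub_slope_le`: fundamental theorem of calculus and Cauchy's estimate,
   with `‖ζ''‖ ≤ 4(‖w‖+3)³` near the line from the tree's cubic bound `norm_riemannZeta_le_cube`).

Everything here is proved; no numerical datum enters.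

## References

* A. M. Odlyzko, H. J. J. te Riele, *Disproof of the Mertens conjecture*, J. reine angew. Math.
  357 (1985), 138–160, §4. [OdlyzkoTeRiele1985]
* R. P. Brent, *On the zeros of the Riemann zeta function in the critical strip*, Math. Comp. 33
  (1979), §3–4 (locating zeros on the line by sign changes; counting by Turing/Backlund). [Brent1979]
* E. C. Titchmarsh, *The Theory of the Riemann Zeta-Function*, 2nd ed. (1986), §9.3 (Backlund).
-/

noncomputable section

open Complex Filter Topology Set MeasureTheory intervalIntegral Finset Metric
open scoped Real ComplexConjugate

namespace Literature.NumberTheory.LFunctions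

/-! ## 1. The twisted sign test -/

/-- `ζ(½+it) = e^{-iθ(t)} Z(t)`. [folklore] -/
lemma riemannZeta_half_eq_hardyZ (t : ℝ) :
    riemannZeta (1 / 2 + t * I) = cexp (-(riemannSiegelTheta t * I)) * hardyZ t := by
  rw [ofReal_hardyZ_holds t, ← mul_assoc, ← Complex.exp_add, neg_add_cancel, Complex.exp_zero,
    one_mul]

/-- **Twisted sign test.** If `Re (ζ(½+it₁) · conj ζ(½+it₂)) < 0` and `|θ(t₂) − θ(t₁)| < π/2`,
then `ζ` has a zero `½ + iγ` with `t₁ ≤ γ ≤ t₂` (indeed `ζ(½+it) = e^{-iθ(t)} Z(t)` with `Z` real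
and continuous, and `Re (ζ₁ conj ζ₂) = Z(t₁) Z(t₂) cos(θ₂ − θ₁)`). [cite: Brent1979, §3 (sign changes of Z locate zeros on the line)] -/
theorem exists_zero_Icc_of_re_mul_conj_neg {t₁ t₂ : ℝ} (h12 : t₁ ≤ t₂)
    (hθ : |riemannSiegelTheta t₂ - riemannSiegelTheta t₁| < π / 2)
    (hneg : (riemannZeta (1 / 2 + t₁ * I) * conj (riemannZeta (1 / 2 + t₂ * I))).re < 0) :
    ∃ γ ∈ Set.Icc t₁ t₂, riemannZeta (1 / 2 + γ * I) = 0 := by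
  by_contra hno
  push Not at hno
  have hZne : ∀ t ∈ Set.Icc t₁ t₂, hardyZ t ≠ 0 := fun t ht h0 ↦
    hno t ht ((hardyZ_eq_zero_iff_holds t).1 h0)
  -- `Z(t₁) Z(t₂) > 0` by the intermediate value theorem
  have hprod : 0 < hardyZ t₁ * hardyZ t₂ := by
    by_contra hle
    push Not at hle
    have hivt : ∃ t ∈ Set.Icc t₁ t₂, hardyZ t = 0 := by
      rcases le_or_gt 0 (hardyZ t₁) with h1 | h1
      · have h2 : hardyZ t₂ ≤ 0 := by
          by_contra h2; push Not at h2
          have := mul_pos (lt_of_le_of_ne h1 (fun h ↦ hZne t₁ ⟨le_rfl, h12⟩ h.symm)) h2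
          linarith
        obtain ⟨t, ht, h0⟩ := intermediate_value_Icc' h12 continuous_hardyZ.continuousOn ⟨h2, h1⟩
        exact ⟨t, ht, h0⟩
      · have h2 : 0 ≤ hardyZ t₂ := by
          by_contra h2; push Not at h2
          have := mul_pos_of_neg_of_neg h1 h2
          linarith
        obtain ⟨t, ht, h0⟩ := intermediate_value_Icc h12 continuous_hardyZ.continuousOn ⟨h1.le, h2⟩
        exact ⟨t, ht, h0⟩
    obtain ⟨t, ht, h0⟩ := hivt
    exact hZne t ht h0
  -- `Re (ζ₁ conj ζ₂) = Z₁ Z₂ cos(θ₂ - θ₁)`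
  have hre : (riemannZeta (1 / 2 + t₁ * I) * conj (riemannZeta (1 / 2 + t₂ * I))).re =
      hardyZ t₁ * hardyZ t₂ * Real.cos (riemannSiegelTheta t₂ - riemannSiegelTheta t₁) := by
    rw [riemannZeta_half_eq_hardyZ, riemannZeta_half_eq_hardyZ, map_mul, Complex.conj_ofReal,
      ← Complex.exp_conj, map_neg, map_mul, Complex.conj_ofReal, Complex.conj_I]
    have : cexp (-(riemannSiegelTheta t₁ * I)) * hardyZ t₁ *
        (cexp (-(riemannSiegelTheta t₂ * -I)) * hardyZ t₂) =
        (hardyZ t₁ * hardyZ t₂ : ℝ) *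
          cexp (((riemannSiegelTheta t₂ - riemannSiegelTheta t₁ : ℝ)) * I) := by
      push_cast
      rw [show ((riemannSiegelTheta t₂ : ℂ) - riemannSiegelTheta t₁) * I =
        -(riemannSiegelTheta t₁ * I) + -(riemannSiegelTheta t₂ * -I) by ring, Complex.exp_add]
      ring
    rw [this, Complex.re_ofReal_mul, Complex.exp_ofReal_mul_I_re]
  have hcos : 0 < Real.cos (riemannSiegelTheta t₂ - riemannSiegelTheta t₁) := by
    apply Real.cos_pos_of_mem_Ioo
    constructor <;> linarith [(abs_lt.1 hθ).1, (abs_lt.1 hθ).2]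
  have := mul_pos hprod hcos
  linarith

/-- `|θ'(u)| ≤ 10` for `1 ≤ u ≤ 2²⁰` (from `|θ'(u) − ½ log(u/2π)| ≤ 2/u`). [folklore] -/
lemma abs_riemannSiegelThetaDeriv_le_ten {u : ℝ} (h1 : 1 ≤ u) (h2 : u ≤ 2 ^ 20) :
    |riemannSiegelThetaDeriv u| ≤ 10 := by
  have h := abs_riemannSiegelThetaDeriv_sub_log_le h1
  have hπ := Real.pi_gt_three
  have hπ4 := Real.pi_lt_four
  have hu0 : 0 < u := by linarith
  -- `|log (u/2π)| ≤ 14`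
  have hlog : |Real.log (u / (2 * π))| ≤ 14 := by
    rw [abs_le]
    constructor
    · have : Real.log (1 / 8) ≤ Real.log (u / (2 * π)) := by
        apply Real.log_le_log (by norm_num)
        rw [div_le_div_iff₀ (by norm_num) (by positivity)]
        nlinarith
      have h8 : Real.log (1 / 8) = -(3 * Real.log 2) := by
        rw [one_div, Real.log_inv, show (8 : ℝ) = 2 ^ 3 by norm_num, Real.log_pow]; ring
      have hl2 := Real.log_two_lt_d9
      linarith
    · have : Real.log (u / (2 * π)) ≤ Real.log (2 ^ 20) := by
        apply Real.log_le_log (by positivity)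
        rw [div_le_iff₀ (by positivity)]
        nlinarith
      rw [Real.log_pow] at this
      have hl2 := Real.log_two_lt_d9
      push_cast at this
      linarith
  have h2u : 2 / u ≤ 2 := by rw [div_le_iff₀ hu0]; linarith
  have := abs_sub_abs_le_abs_sub (riemannSiegelThetaDeriv u) (Real.log (u / (2 * π)) / 2)
  rw [abs_div, abs_two] at this
  linarith

/-- For `1 ≤ t₁ ≤ t₂ ≤ 2²⁰`: `|θ(t₂) − θ(t₁)| ≤ 10 (t₂ − t₁)` (mean value theorem). [folklore] -/
theorem MertensZeroCertificate.abs_riemannSiegelTheta_sub_le {t₁ t₂ : ℝ} (h1 : 1 ≤ t₁) (h12 : t₁ ≤ t₂)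
    (h2 : t₂ ≤ 2 ^ 20) :
    |riemannSiegelTheta t₂ - riemannSiegelTheta t₁| ≤ 10 * (t₂ - t₁) := by
  rcases h12.eq_or_lt with heq | hlt
  · subst heq; simp
  obtain ⟨c, hc, hderiv⟩ := exists_hasDerivAt_eq_slope riemannSiegelTheta riemannSiegelThetaDeriv
    hlt continuous_riemannSiegelTheta.continuousOn
    (fun x _ ↦ hasDerivAt_riemannSiegelTheta_holds x)
  have hb := abs_riemannSiegelThetaDeriv_le_ten (u := c) (by linarith [hc.1]) (by linarith [hc.2])
  rw [hderiv] at hb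
  rw [abs_div, abs_of_pos (by linarith : 0 < t₂ - t₁), div_le_iff₀ (by linarith)] at hb
  exact hb

/-- The twisted sign test in the form used by certificates: `2 ≤ t₁ ≤ t₂ ≤ 2²⁰`,
`t₂ − t₁ ≤ 1/8`. [cite: Brent1979, §3 (sign changes of Z locate zeros on the line)] -/
theorem exists_zero_Icc_of_re_mul_conj_neg' {t₁ t₂ : ℝ} (h1 : 1 ≤ t₁) (h12 : t₁ ≤ t₂)
    (h2 : t₂ ≤ 2 ^ 20) (hgap : t₂ - t₁ ≤ 1 / 8)
    (hneg : (riemannZeta (1 / 2 + t₁ * I) * conj (riemannZeta (1 / 2 + t₂ * I))).re < 0) :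
    ∃ γ ∈ Set.Icc t₁ t₂, riemannZeta (1 / 2 + γ * I) = 0 := by
  refine exists_zero_Icc_of_re_mul_conj_neg h12 ?_ hneg
  have := MertensZeroCertificate.abs_riemannSiegelTheta_sub_le h1 h12 h2
  have hπ := Real.pi_gt_three
  linarith

/-! ## 2. The zero count from a certificate along the top edge -/

/-- If `ζ ≠ 0` on `[½, 2] × {T}` (`T ≠ 0`) then `T` is not the ordinate of any zero (zeros with
`Re ρ < ½` reflect to `1 − ρ̄`, with the same ordinate). [folklore] -/
lemma not_ordinate_of_ne_zero_Icc {T : ℝ} (hT : T ≠ 0)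
    (h : ∀ x ∈ Set.Icc (1 / 2 : ℝ) 2, riemannZeta (x + T * I) ≠ 0) :
    ∀ ρ : ℂ, riemannZeta ρ = 0 → ρ.im ≠ T := by
  intro ρ hρ hρT
  have him : ρ.im ≠ 0 := by rw [hρT]; exact hT
  obtain ⟨h0, h1⟩ := re_mem_Ioo_of_riemannZeta_eq_zero_of_im_ne_zero hρ him
  rcases le_or_gt (1 / 2) ρ.re with hge | hlt
  · have := h ρ.re ⟨hge, by linarith⟩
    apply this
    convert hρ using 2
    apply Complex.ext <;> simp [hρT]
  · -- reflect
    have hz : riemannZeta (1 - conj ρ) = 0 := by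
      have h1' : riemannZeta (1 - ρ) = 0 := LevinsonMontgomery.riemannZeta_one_sub_eq_zero h0 hρ
      have : 1 - conj ρ = conj (1 - ρ) := by simp
      rw [this, riemannZeta_conj, h1', map_zero]
    have := h (1 - ρ.re) ⟨by linarith, by linarith⟩
    apply this
    convert hz using 2
    apply Complex.ext <;> simp [hρT]

/-- **The zero count from a top-edge certificate.** Let `T > 0` and let the values of `ζ` along
`[½, 2] × {T}` be covered by a valid piece list (`WindingCertificate.lean`) starting at `½`, ending
at `2` with last label `0`. Then
`N(T) = θ(T)/π + 1 + a/π − turns/2` for some `|a| < π/2` (`a = arg (qrot d₁ · ζ(½+iT))`):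
Backlund's `πS(T) = arg ζ(2+iT) − Im ∫_{1/2}^{2} ζ'/ζ(x+iT) dx` with the edge integral evaluated
exactly by the certificate. [cite: Titchmarsh1986, Thm. 9.3] -/
theorem MertensZeroCertificate.zetaZeroCount_eq_of_hpieces {T : ℝ} (hT : 0 < T) {x₁ : ℝ} {d₁ : Fin 4}
    {L : List (ℝ × Fin 4)}
    (hP : Literature.Analysis.Complex.HPieces riemannZeta T (1 / 2) ((x₁, d₁) :: L))
    (hlast : Literature.Analysis.Complex.piecesLast x₁ L = 2) (hdir : Literature.Analysis.Complex.piecesLastDir d₁ L = 0) :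
    ∃ a : ℝ, |a| < π / 2 ∧
      (zetaZeroCount T : ℝ) = riemannSiegelTheta T / π + 1 + a / π -
        (Literature.Analysis.Complex.piecesTurns d₁ L : ℝ) / 2 := by
  have hπ : 0 < π := Real.pi_pos
  -- `ζ ≠ 0` on the edge, so `T` is not an ordinate
  have hne : ∀ x ∈ Set.Icc (1 / 2 : ℝ) 2, riemannZeta (x + T * I) ≠ 0 := by
    intro x hx
    have := hP.ne_zero x (by change x ∈ Set.Icc (1 / 2 : ℝ) (Literature.Analysis.Complex.piecesLast x₁ L); rw [hlast]; exact hx)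
      (by simp)
    exact this
  have hT' := not_ordinate_of_ne_zero_Icc hT.ne' hne
  have hB := pi_mul_zetaArgS_eq hT hT'
  -- analyticity along the edge and the vertical side
  have hne1 : ∀ x : ℝ, (x : ℂ) + T * I ≠ 1 := fun x h ↦ by
    have := congrArg Complex.im h; simp at this; exact hT.ne' this
  have han : ∀ x ∈ Set.Icc (1 / 2 : ℝ) (Literature.Analysis.Complex.piecesLast x₁ L),
      AnalyticAt ℂ riemannZeta (x + T * I) := fun x _ ↦ analyticOn_riemannZeta _ (hne1 x)
  have hH := Literature.Analysis.Complex.integral_logDeriv_hpieces hP han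
  have hq0 : Literature.Analysis.Complex.qrot 0 = 1 := rfl
  rw [hlast, hdir, hq0, one_mul] at hH
  -- the vertical side: `I ∫₀ᵀ ζ'/ζ(2+iy) dy = log ζ(2+iT) - log ζ(2)`
  have hne2 : ∀ y : ℝ, ((2 : ℝ) : ℂ) + y * I ≠ 1 := fun y h ↦ by
    have := congrArg Complex.re h; norm_num at this
  have hV := Literature.Analysis.Complex.integral_logDeriv_vertical (g := riemannZeta) (2 : ℝ) hT.le
    (fun y _ ↦ analyticOn_riemannZeta _ (hne2 y))
    (fun y _ ↦ by
      left
      have := re_riemannZeta_two_add_pos y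
      push_cast at this ⊢
      exact this)
  have h2 : ((2 : ℝ) : ℂ) = 2 := by push_cast; rfl
  simp only [h2] at hV
  rw [hV] at hB
  have hlast2 : ((2 : ℝ) : ℂ) + T * I = 2 + T * I := by push_cast; ring
  rw [hlast2] at hH
  rw [hH] at hB
  -- `ζ(2) > 0`
  have hζ2 : Complex.log (riemannZeta (2 + (0 : ℝ) * I)) = (Real.log (riemannZeta 2).re : ℂ) := by
    simp only [Complex.ofReal_zero, zero_mul, add_zero]
    have hpos : 0 < (riemannZeta 2).re := by simpa using re_riemannZeta_two_add_pos 0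
    have him : (riemannZeta 2).im = 0 := by
      rw [riemannZeta_two]; simp [← Complex.ofReal_pow]
    have : riemannZeta 2 = ((riemannZeta 2).re : ℂ) := Complex.ext (by simp) (by simp [him])
    rw [this, ← Complex.ofReal_log hpos.le]
    simp
  rw [hζ2] at hB
  -- assemble
  set a : ℝ := arg (Literature.Analysis.Complex.qrot d₁ * riemannZeta (((1 / 2 : ℝ) : ℂ) + T * I)) with ha
  have hapos : 0 < (Literature.Analysis.Complex.qrot d₁ * riemannZeta (((1 / 2 : ℝ) : ℂ) + T * I)).re :=
    hP.re_pos_head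
  refine ⟨a, ?_, ?_⟩
  · exact abs_arg_lt_pi_div_two_iff.2 (Or.inl hapos)
  · have e3 : ((Literature.Analysis.Complex.piecesTurns d₁ L : ℤ) : ℂ) * ((π : ℂ) / 2) * I =
        (((Literature.Analysis.Complex.piecesTurns d₁ L : ℝ) * (π / 2) : ℝ) : ℂ) * I := by push_cast; ring
    rw [e3] at hB
    simp only [Complex.sub_im, Complex.add_im, Complex.ofReal_im, Complex.log_im, Complex.mul_im,
      Complex.ofReal_re, Complex.I_re, Complex.I_im, mul_one, mul_zero, add_zero, sub_zero] at hB
    have key : π * ((zetaZeroCount T : ℝ) - riemannSiegelTheta T / π - 1) =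
        a - (Literature.Analysis.Complex.piecesTurns d₁ L : ℝ) * (π / 2) := by
      have := hB
      unfold zetaArgS at this
      rw [ha]
      linarith
    field_simp at key
    field_simp
    linarith

/-- The count as an integer: under the hypotheses of `zetaZeroCount_eq_of_hpieces`, if
`θ(T)/π + 1 − turns/2` lies within `½` of the natural number `n` (strictly on one side) then
`N(T) = n`. [cite: Titchmarsh1986, Thm. 9.3] -/
theorem zetaZeroCount_eq_of_hpieces_of_abs_lt {T : ℝ} (hT : 0 < T) {x₁ : ℝ} {d₁ : Fin 4}
    {L : List (ℝ × Fin 4)}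
    (hP : Literature.Analysis.Complex.HPieces riemannZeta T (1 / 2) ((x₁, d₁) :: L))
    (hlast : Literature.Analysis.Complex.piecesLast x₁ L = 2) (hdir : Literature.Analysis.Complex.piecesLastDir d₁ L = 0)
    {n : ℕ}
    (hV : |riemannSiegelTheta T / π + 1 - (Literature.Analysis.Complex.piecesTurns d₁ L : ℝ) / 2 - n| ≤ 1 / 2) :
    zetaZeroCount T = n := by
  obtain ⟨a, ha, hN⟩ := MertensZeroCertificate.zetaZeroCount_eq_of_hpieces hT hP hlast hdir
  have hπ : 0 < π := Real.pi_pos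
  have haπ : |a / π| < 1 / 2 := by
    rw [abs_div, abs_of_pos hπ, div_lt_iff₀ hπ]; linarith
  have h1 : |(zetaZeroCount T : ℝ) - n| < 1 := by
    have := abs_add_le (riemannSiegelTheta T / π + 1 - (Literature.Analysis.Complex.piecesTurns d₁ L : ℝ) / 2 - n) (a / π)
    rw [hN]
    calc _ = |riemannSiegelTheta T / π + 1 - (Literature.Analysis.Complex.piecesTurns d₁ L : ℝ) / 2 - n + a / π| := by
          congr 1; ring
      _ < 1 := by linarith [abs_lt.1 haπ]
  have h2 : |((zetaZeroCount T : ℤ) : ℝ) - ((n : ℤ) : ℝ)| < 1 := by push_cast; exact h1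
  rw [← Int.cast_sub, ← Int.cast_abs] at h2
  have h3 : |((zetaZeroCount T : ℤ)) - (n : ℤ)| < 1 := by exact_mod_cast h2
  have : (zetaZeroCount T : ℤ) = n := by
    have := abs_lt.1 h3; omega
  exact_mod_cast this

/-- The same with `θ(T)` replaced by its Stirling approximation
`M(T) = (T/2) log(T/2π) − T/2 − π/8` and the explicit error `2K(¼)/T`
(`Literature.NumberTheory.LFunctions.abs_riemannSiegelTheta_sub_stirling_le`): if
`|M(T)/π + 1 − turns/2 − n| + 2K(¼)/(πT) ≤ ½` then `N(T) = n` (`T ≥ 2`). [cite: Titchmarsh1986, Thm. 9.3 and §4.17] -/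
theorem MertensZeroCertificate.zetaZeroCount_eq_of_hpieces_stirling {T : ℝ} (hT : 2 ≤ T) {x₁ : ℝ} {d₁ : Fin 4}
    {L : List (ℝ × Fin 4)}
    (hP : Literature.Analysis.Complex.HPieces riemannZeta T (1 / 2) ((x₁, d₁) :: L))
    (hlast : Literature.Analysis.Complex.piecesLast x₁ L = 2) (hdir : Literature.Analysis.Complex.piecesLastDir d₁ L = 0)
    {n : ℕ}
    (hV : |(T / 2 * Real.log (T / (2 * π)) - T / 2 - π / 8) / π + 1 -
        (Literature.Analysis.Complex.piecesTurns d₁ L : ℝ) / 2 - n| + 2 * stirlingVertRate (1 / 4) / (π * T) ≤ 1 / 2) :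
    zetaZeroCount T = n := by
  have hπ : 0 < π := Real.pi_pos
  have hT0 : 0 < T := by linarith
  refine zetaZeroCount_eq_of_hpieces_of_abs_lt hT0 hP hlast hdir ?_
  have hS := abs_riemannSiegelTheta_sub_stirling_le hT
  have h1 : |riemannSiegelTheta T / π - (T / 2 * Real.log (T / (2 * π)) - T / 2 - π / 8) / π| ≤
      2 * stirlingVertRate (1 / 4) / (π * T) := by
    rw [← sub_div, abs_div, abs_of_pos hπ, div_le_iff₀ hπ]
    calc _ ≤ 2 * stirlingVertRate (1 / 4) / T := hS
      _ = _ := by field_simp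
  calc _ = |((T / 2 * Real.log (T / (2 * π)) - T / 2 - π / 8) / π + 1 -
        (Literature.Analysis.Complex.piecesTurns d₁ L : ℝ) / 2 - n) +
        (riemannSiegelTheta T / π - (T / 2 * Real.log (T / (2 * π)) - T / 2 - π / 8) / π)| := by
          congr 1; ring
    _ ≤ _ := abs_add_le _ _
    _ ≤ 1 / 2 := by linarith

/-! ## 3. The zero clause from the count and the located zeros -/

/-- A zero of `ζ` of order one has `ζ' ≠ 0` there. [folklore] -/
lemma deriv_ne_zero_of_order_eq_one {ρ : ℂ} (hρ1 : ρ ≠ 1) (hord : riemannZetaZeroOrder ρ = 1) :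
    deriv riemannZeta ρ ≠ 0 := by
  have ha : AnalyticAt ℂ riemannZeta ρ := analyticOn_riemannZeta ρ hρ1
  have h1 : analyticOrderAt riemannZeta ρ = 1 := by
    have h := hord
    rw [riemannZetaZeroOrder, ha.meromorphicOrderAt_eq] at h
    cases hq : analyticOrderAt riemannZeta ρ with
    | top => rw [hq] at h; simp at h
    | coe m =>
      rw [hq] at h
      simp [ENat.map_coe] at h
      have : (m : ℤ) = 1 := by exact_mod_cast h
      have hm : m = 1 := by exact_mod_cast this
      rw [hm]; rfl
  obtain ⟨g, hg, hg0, hfg⟩ := (ha.analyticOrderAt_eq_natCast (n := 1)).1 (by exact_mod_cast h1)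
  have hderiv : HasDerivAt (fun z ↦ (z - ρ) ^ 1 • g z) (g ρ) ρ := by
    have h1 : HasDerivAt (fun z : ℂ ↦ z - ρ) 1 ρ := (hasDerivAt_id ρ).sub_const ρ
    have h2 := h1.mul hg.differentiableAt.hasDerivAt
    have h3 : HasDerivAt (fun y : ℂ ↦ (y - ρ) * g y) (g ρ) ρ := by
      have := h2
      simp only [one_mul, sub_self, zero_mul, add_zero] at this
      exact this
    refine h3.congr_of_eventuallyEq (Filter.Eventually.of_forall fun z ↦ ?_)
    simp [smul_eq_mul]
  have heq : deriv riemannZeta ρ = g ρ := by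
    rw [Filter.EventuallyEq.deriv_eq hfg]
    exact hderiv.deriv
  rw [heq]; exact hg0

/-- If a sum of terms `≥ 1` over a finset equals its cardinality, every term is `1`. [folklore] -/
lemma eq_one_of_sum_eq_card {α : Type*} (s : Finset α) (f : α → ℤ) (h1 : ∀ x ∈ s, 1 ≤ f x)
    (hs : ∑ x ∈ s, f x = s.card) : ∀ x ∈ s, f x = 1 := by
  have hle : ∑ x ∈ s, (1 : ℤ) ≤ ∑ x ∈ s, f x := Finset.sum_le_sum h1
  have heq : ∑ x ∈ s, (1 : ℤ) = ∑ x ∈ s, f x := by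
    refine le_antisymm hle ?_
    rw [hs]; simp
  intro x hx
  have := (Finset.sum_eq_sum_iff_of_le h1).1 heq x hx
  exact this.symm

/-- **The zero clause.** If `N(T) = n` and `n` distinct ordinates `0 < γ < T` of zeros of `ζ` on
the critical line are known, then every zero `ρ` of `ζ` with `0 < Re ρ < 1` and `|Im ρ| < T` lies
on the critical line, is simple, and (if `Im ρ > 0`) has its ordinate among the `γ`'s.
(`N` counts with multiplicity: the located zeros already exhaust it.) [cite: Brent1979, §4 (N(T) equal to the number of sign changes found ⇒ all zeros simple and on the line)] -/
theorem zeros_below_of_count_eq_card {T : ℝ} (Z : Finset ℝ)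
    (hZ : ∀ γ ∈ Z, riemannZeta (1 / 2 + γ * I) = 0 ∧ 0 < γ ∧ γ < T)
    (hN : zetaZeroCount T = Z.card) :
    (∀ ρ : ℂ, riemannZeta ρ = 0 → 0 < ρ.re → ρ.re < 1 → |ρ.im| < T →
        ρ.re = 1 / 2 ∧ deriv riemannZeta ρ ≠ 0) ∧
      (∀ ρ : ℂ, riemannZeta ρ = 0 → 0 < ρ.re → ρ.re < 1 → 0 < ρ.im → ρ.im < T → ρ.im ∈ Z) := by
  classical
  -- the box and the located zeros
  have hfin : (zetaZeroBox 0 T).Finite := zetaZeroBox_finite 0 T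
  set B : Finset ℂ := hfin.toFinset with hBdef
  set e : ℝ → ℂ := fun γ ↦ 1 / 2 + γ * I with he
  have heinj : Function.Injective e := by
    intro x y hxy
    have := congrArg Complex.im hxy
    simpa [he] using this
  set E : Finset ℂ := Z.image e with hE
  have hEcard : E.card = Z.card := Finset.card_image_of_injective _ heinj
  have hEB : E ⊆ B := by
    intro ρ hρ
    rw [hE, Finset.mem_image] at hρ
    obtain ⟨γ, hγ, rfl⟩ := hρ
    obtain ⟨h0, h1, h2⟩ := hZ γ hγ
    rw [hBdef, Set.Finite.mem_toFinset]
    have hre : (e γ).re = 1 / 2 := by simp [he]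
    have him : (e γ).im = γ := by simp [he]
    refine ⟨h0, ?_, ?_, ?_, ?_⟩
    · rw [hre]; norm_num
    · rw [hre]; norm_num
    · rw [him]; exact h1
    · rw [him]; exact h2.le
  -- orders are `≥ 1` on the box
  have hne1 : ∀ ρ ∈ B, ρ ≠ 1 := by
    intro ρ hρ h1
    rw [hBdef, Set.Finite.mem_toFinset] at hρ
    have := hρ.2.2.2.1
    rw [h1] at this; simp at this
  have hord1 : ∀ ρ ∈ B, 1 ≤ riemannZetaZeroOrder ρ := by
    intro ρ hρ
    have hρ' := hρ
    rw [hBdef, Set.Finite.mem_toFinset] at hρ'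
    have := (riemannZetaZeroOrder_pos_iff (hne1 ρ hρ)).2 hρ'.1
    omega
  -- the count as a `Finset.sum`
  have hsumB : (∑ ρ ∈ B, riemannZetaZeroOrder ρ) = Z.card := by
    have h1 : (∑ᶠ ρ ∈ zetaZeroBox 0 T, riemannZetaZeroOrder ρ) = ∑ ρ ∈ B, riemannZetaZeroOrder ρ :=
      finsum_mem_eq_finite_toFinset_sum _ hfin
    have h2 : zetaZeroCount T = (∑ᶠ ρ ∈ zetaZeroBox 0 T, riemannZetaZeroOrder ρ).toNat := rfl
    rw [h2, h1] at hN
    have hnn : 0 ≤ ∑ ρ ∈ B, riemannZetaZeroOrder ρ :=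
      Finset.sum_nonneg fun ρ hρ ↦ by linarith [hord1 ρ hρ]
    have := Int.toNat_of_nonneg hnn
    rw [hN] at this
    exact_mod_cast this.symm
  -- hence `B = E` and all orders are `1`
  have hsplit := Finset.sum_sdiff hEB (f := riemannZetaZeroOrder)
  have hsumE : (E.card : ℤ) ≤ ∑ ρ ∈ E, riemannZetaZeroOrder ρ := by
    have := Finset.sum_le_sum fun ρ hρ ↦ hord1 ρ (hEB hρ)
    simpa using this
  have hsumD : ((B \ E).card : ℤ) ≤ ∑ ρ ∈ B \ E, riemannZetaZeroOrder ρ := by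
    have := Finset.sum_le_sum (s := B \ E) (f := fun _ ↦ (1 : ℤ)) (g := riemannZetaZeroOrder)
      (fun ρ hρ ↦ hord1 ρ (Finset.sdiff_subset hρ))
    simpa using this
  have hDcard : (B \ E).card = 0 := by
    have : ((B \ E).card : ℤ) ≤ 0 := by
      rw [← hsplit, ← hEcard] at hsumB
      linarith
    exact_mod_cast le_antisymm this (by positivity)
  have hBE : B = E := by
    have := Finset.card_eq_zero.1 hDcard
    rw [Finset.sdiff_eq_empty_iff_subset] at this
    exact Finset.Subset.antisymm this hEB
  have hordE : ∀ ρ ∈ E, riemannZetaZeroOrder ρ = 1 := by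
    apply eq_one_of_sum_eq_card E _ (fun ρ hρ ↦ hord1 ρ (hEB hρ))
    rw [← hBE, hsumB, ← hEcard, hBE]
  -- zeros with positive ordinate `< T`
  have hpos : ∀ ρ : ℂ, riemannZeta ρ = 0 → 0 < ρ.re → ρ.re < 1 → 0 < ρ.im → ρ.im < T →
      ρ ∈ E := by
    intro ρ h0 h1 h2 h3 h4
    rw [← hBE, hBdef, Set.Finite.mem_toFinset]
    exact ⟨h0, h1.le, h2.le, h3, h4.le⟩
  have hposE : ∀ ρ ∈ E, ρ.re = 1 / 2 ∧ deriv riemannZeta ρ ≠ 0 ∧ ρ.im ∈ Z := by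
    intro ρ hρ
    have hord := hordE ρ hρ
    have hρ1 := hne1 ρ (hEB hρ)
    rw [hE, Finset.mem_image] at hρ
    obtain ⟨γ, hγ, rfl⟩ := hρ
    refine ⟨by simp [he], deriv_ne_zero_of_order_eq_one hρ1 hord, by simpa [he] using hγ⟩
  refine ⟨fun ρ h0 h1 h2 h3 ↦ ?_, fun ρ h0 h1 h2 h3 h4 ↦ (hposE ρ (hpos ρ h0 h1 h2 h3 h4)).2.2⟩
  rcases lt_trichotomy ρ.im 0 with hlt | heq | hgt
  · -- conjugate zero
    have hc : conj ρ ∈ E := hpos (conj ρ) (by rw [riemannZeta_conj, h0, map_zero])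
      (by simpa using h1) (by simpa using h2) (by simp; linarith)
      (by simp; linarith [(abs_lt.1 h3).1])
    obtain ⟨hre, hd, -⟩ := hposE _ hc
    refine ⟨by simpa using hre, fun hd0 ↦ hd ?_⟩
    rw [deriv_riemannZeta_conj, hd0, map_zero]
  · -- no real zeros in the strip
    exfalso
    have : ρ = ((ρ.re : ℝ) : ℂ) := Complex.ext (by simp) (by simp [heq])
    rw [this] at h0
    exact riemannZeta_ne_zero_of_mem_Ioo_holds ρ.re h1 h2 h0
  · obtain ⟨hre, hd, -⟩ := hposE ρ (hpos ρ h0 h1 h2 hgt (abs_lt.1 h3).2)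
    exact ⟨hre, hd⟩

/-! ## 4. `h_K(y)` as a sum over the certified ordinates -/

/-- Under the conclusion of `zeros_below_of_count_eq_card`, the finite set of zeros below `T`
(`Literature.NumberTheory.LFunctions.zetaZerosBelow`) is `{½ ± iγ : γ ∈ Z}`. [folklore] -/
theorem zetaZerosBelow_toFinset_eq {T : ℝ} (Z : Finset ℝ)
    (hZ : ∀ γ ∈ Z, riemannZeta (1 / 2 + γ * I) = 0 ∧ 0 < γ ∧ γ < T)
    (hline : ∀ ρ : ℂ, riemannZeta ρ = 0 → 0 < ρ.re → ρ.re < 1 → |ρ.im| < T → ρ.re = 1 / 2)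
    (hall : ∀ ρ : ℂ, riemannZeta ρ = 0 → 0 < ρ.re → ρ.re < 1 → 0 < ρ.im → ρ.im < T → ρ.im ∈ Z) :
    (zetaZerosBelow_finite T).toFinset =
      Z.image (fun γ : ℝ ↦ 1 / 2 + γ * I) ∪ Z.image (fun γ : ℝ ↦ 1 / 2 - γ * I) := by
  classical
  ext ρ
  rw [Set.Finite.mem_toFinset, mem_zetaZerosBelow, Finset.mem_union, Finset.mem_image,
    Finset.mem_image]
  constructor
  · rintro ⟨h0, h1, h2, h3⟩
    have hre := hline ρ h0 h1 h2 h3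
    rcases lt_trichotomy ρ.im 0 with hlt | heq | hgt
    · right
      refine ⟨-ρ.im, ?_, ?_⟩
      · have := hall (conj ρ) (by rw [riemannZeta_conj, h0, map_zero]) (by simpa using h1)
          (by simpa using h2) (by simp; linarith) (by simp; linarith [(abs_lt.1 h3).1])
        simpa using this
      · apply Complex.ext <;> simp [hre]
    · exfalso
      have : ρ = ((ρ.re : ℝ) : ℂ) := Complex.ext (by simp) (by simp [heq])
      rw [this] at h0
      exact riemannZeta_ne_zero_of_mem_Ioo_holds ρ.re h1 h2 h0
    · left
      refine ⟨ρ.im, hall ρ h0 h1 h2 hgt (abs_lt.1 h3).2, ?_⟩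
      apply Complex.ext <;> simp [hre]
  · rintro (⟨γ, hγ, rfl⟩ | ⟨γ, hγ, rfl⟩)
    · obtain ⟨h0, h1, h2⟩ := hZ γ hγ
      refine ⟨h0, by simp, by norm_num, ?_⟩
      simp [abs_lt]; constructor <;> linarith
    · obtain ⟨h0, h1, h2⟩ := hZ γ hγ
      refine ⟨?_, by simp, by norm_num, ?_⟩
      · have : (1 / 2 : ℂ) - γ * I = conj (1 / 2 + γ * I) := by
          apply Complex.ext <;> simp
        rw [this, riemannZeta_conj, h0, map_zero]
      · simp [abs_lt]; constructor <;> linarith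

/-- **`h_K(y)` over the certified zeros.** For a kernel transform `k` that is real and even on the
ordinates, `Re h_K(y) = Σ_{γ ∈ Z} 2 Re [k(γ) e^{iγy} / (ρ ζ'(ρ))]`, `ρ = ½ + iγ` (the zeros come in
conjugate pairs `½ ± iγ` contributing conjugate terms; `ζ'(ρ̄) = conj ζ'(ρ)`). [cite: OdlyzkoTeRiele1985, Theorem p. 144 (display after (2.18)); §4.3] -/
theorem re_inghamSum_eq_sum_of_zeros {T : ℝ} (Z : Finset ℝ)
    (hZ : ∀ γ ∈ Z, riemannZeta (1 / 2 + γ * I) = 0 ∧ 0 < γ ∧ γ < T)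
    (hline : ∀ ρ : ℂ, riemannZeta ρ = 0 → 0 < ρ.re → ρ.re < 1 → |ρ.im| < T → ρ.re = 1 / 2)
    (hall : ∀ ρ : ℂ, riemannZeta ρ = 0 → 0 < ρ.re → ρ.re < 1 → 0 < ρ.im → ρ.im < T → ρ.im ∈ Z)
    (k : ℝ → ℂ) (hk_even : ∀ t, k (-t) = k t) (hk_real : ∀ t, conj (k t) = k t) (y : ℝ) :
    (inghamSum k T y).re =
      ∑ γ ∈ Z, 2 * (k γ * cexp (I * (γ * y)) /
        ((1 / 2 + γ * I) * deriv riemannZeta (1 / 2 + γ * I))).re := by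
  classical
  unfold inghamSum
  set F : ℂ → ℂ := fun ρ ↦ k ρ.im * cexp (I * (ρ.im * y)) / (ρ * deriv riemannZeta ρ) with hFdef
  have hF : ∀ ρ : ℂ, F (conj ρ) = conj (F ρ) := by
    intro ρ
    simp only [hFdef, Complex.conj_im, map_div₀, map_mul, hk_real, deriv_riemannZeta_conj,
      ← Complex.exp_conj, Complex.conj_I, Complex.conj_ofReal, hk_even]
    congr 2
    push_cast
    ring
  rw [zetaZerosBelow_toFinset_eq Z hZ hline hall]
  have hinj1 : Function.Injective (fun γ : ℝ ↦ (1 / 2 : ℂ) + γ * I) := by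
    intro a b h; have := congrArg Complex.im h; simpa using this
  have hinj2 : Function.Injective (fun γ : ℝ ↦ (1 / 2 : ℂ) - γ * I) := by
    intro a b h; have := congrArg Complex.im h; simpa using this
  have hdisj : Disjoint (Z.image (fun γ : ℝ ↦ (1 / 2 : ℂ) + γ * I))
      (Z.image (fun γ : ℝ ↦ (1 / 2 : ℂ) - γ * I)) := by
    rw [Finset.disjoint_left]
    intro ρ h1 h2
    rw [Finset.mem_image] at h1 h2
    obtain ⟨a, ha, rfl⟩ := h1
    obtain ⟨b, hb, hab⟩ := h2
    have := congrArg Complex.im hab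
    simp at this
    have ha0 := (hZ a ha).2.1
    have hb0 := (hZ b hb).2.1
    linarith
  rw [Finset.sum_union hdisj, Finset.sum_image (fun a _ b _ h ↦ hinj1 h),
    Finset.sum_image (fun a _ b _ h ↦ hinj2 h), Complex.add_re, Complex.re_sum, Complex.re_sum,
    ← Finset.sum_add_distrib]
  refine Finset.sum_congr rfl fun γ _ ↦ ?_
  have hconj : (1 / 2 : ℂ) - γ * I = conj (1 / 2 + γ * I) := by apply Complex.ext <;> simp
  rw [hconj]
  change (F (1 / 2 + γ * I)).re + (F (conj (1 / 2 + γ * I))).re = _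
  rw [hF, Complex.conj_re]
  have hval : F (1 / 2 + γ * I) =
      k γ * cexp (I * (γ * y)) / ((1 / 2 + γ * I) * deriv riemannZeta (1 / 2 + γ * I)) := by
    simp [hFdef]
  rw [hval]
  ring

/-! ## 5. `ζ'(ρ)` from two values of `ζ` -/

/-- `‖ζ''(w)‖ ≤ 4 (‖w‖ + 3)³` for `Re w ≥ ½`, `Im w ≥ 2` (Cauchy's estimate twice, radii `½`, from
`‖ζ(v)‖ ≤ (‖v‖+2)³` on `Re v ≥ −1`, `‖v − 1‖ ≥ 1`). [folklore] -/
theorem norm_deriv2_riemannZeta_le {w : ℂ} (hre : 1 / 2 ≤ w.re) (him : 2 ≤ w.im) :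
    ‖deriv (deriv riemannZeta) w‖ ≤ 4 * (‖w‖ + 3) ^ 3 := by
  -- `ζ` and `ζ'` are differentiable away from `1`
  have hdiff : DifferentiableOn ℂ riemannZeta {1}ᶜ := fun z hz ↦
    (differentiableAt_riemannZeta hz).differentiableWithinAt
  have hdiff' : DifferentiableOn ℂ (deriv riemannZeta) {1}ᶜ :=
    (hdiff.analyticOnNhd isOpen_compl_singleton).deriv.differentiableOn
  have hfar : ∀ u : ℂ, dist u w ≤ 1 → u ≠ 1 := by
    intro u hu h1
    rw [h1, Complex.dist_eq] at hu
    have : |(1 - w).im| ≤ ‖1 - w‖ := Complex.abs_im_le_norm _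
    simp at this
    have := le_abs_self w.im
    linarith
  -- first derivative bound on the ball of radius `1/2`
  have h1 : ∀ u : ℂ, dist u w ≤ 1 / 2 → ‖deriv riemannZeta u‖ ≤ 2 * (‖w‖ + 3) ^ 3 := by
    intro u hu
    have hball : closedBall u (1 / 2) ⊆ {1}ᶜ := by
      intro v hv h1
      have : dist v w ≤ 1 := by
        calc dist v w ≤ dist v u + dist u w := dist_triangle _ _ _
          _ ≤ 1 / 2 + 1 / 2 := add_le_add (mem_closedBall.1 hv) hu
          _ = 1 := by norm_num
      exact hfar v this h1
    have hdc : DiffContOnCl ℂ riemannZeta (ball u (1 / 2)) :=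
      (hdiff.mono (by rw [closure_ball u (by norm_num)]; exact hball)).diffContOnCl
    have hC : ∀ v ∈ sphere u (1 / 2), ‖riemannZeta v‖ ≤ (‖w‖ + 3) ^ 3 := by
      intro v hv
      have hvw : dist v w ≤ 1 := by
        calc dist v w ≤ dist v u + dist u w := dist_triangle _ _ _
          _ ≤ 1 / 2 + 1 / 2 := add_le_add (mem_sphere.1 hv).le hu
          _ = 1 := by norm_num
      have hvre : -1 ≤ v.re := by
        have : |(v - w).re| ≤ ‖v - w‖ := Complex.abs_re_le_norm _
        rw [Complex.dist_eq] at hvw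
        simp at this
        linarith [abs_le.1 (this.trans hvw)]
      have hv1 : 1 ≤ ‖v - 1‖ := by
        have : |(v - 1).im| ≤ ‖v - 1‖ := Complex.abs_im_le_norm _
        have h2 : |(v - w).im| ≤ ‖v - w‖ := Complex.abs_im_le_norm _
        rw [Complex.dist_eq] at hvw
        simp at this h2
        have := abs_le.1 (h2.trans hvw)
        linarith [le_abs_self v.im]
      have := norm_riemannZeta_le_cube hvre hv1
      refine this.trans ?_
      have : ‖v‖ ≤ ‖w‖ + 1 := by
        have := norm_sub_norm_le v w
        rw [← Complex.dist_eq] at this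
        linarith
      have hle : ‖v‖ + 2 ≤ ‖w‖ + 3 := by linarith
      exact pow_le_pow_left₀ (by positivity) hle 3
    have := Complex.norm_deriv_le_of_forall_mem_sphere_norm_le (by norm_num) hdc hC
    calc ‖deriv riemannZeta u‖ ≤ (‖w‖ + 3) ^ 3 / (1 / 2) := this
      _ = 2 * (‖w‖ + 3) ^ 3 := by ring
  -- second derivative
  have hball : closedBall w (1 / 2) ⊆ {1}ᶜ := fun v hv ↦
    hfar v ((mem_closedBall.1 hv).trans (by norm_num))
  have hdc : DiffContOnCl ℂ (deriv riemannZeta) (ball w (1 / 2)) :=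
    (hdiff'.mono (by rw [closure_ball w (by norm_num)]; exact hball)).diffContOnCl
  have := Complex.norm_deriv_le_of_forall_mem_sphere_norm_le (by norm_num) hdc
    (fun v hv ↦ h1 v (mem_sphere.1 hv).le)
  calc ‖deriv (deriv riemannZeta) w‖ ≤ 2 * (‖w‖ + 3) ^ 3 / (1 / 2) := this
    _ = 4 * (‖w‖ + 3) ^ 3 := by ring

/-- **`ζ'(ρ)` from two values.** For `2 ≤ t₁ < t₂` and `t₁ ≤ γ ≤ t₂`:
`‖ζ'(½+iγ) − (ζ(½+it₂) − ζ(½+it₁))/((t₂−t₁) i)‖ ≤ (t₂ − t₁) · 4 (t₂ + 4)³`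
(fundamental theorem of calculus along the segment and the bound on `ζ''`). [folklore] -/
theorem norm_deriv_riemannZeta_sub_slope_le {t₁ t₂ γ : ℝ} (h1 : 2 ≤ t₁) (h12 : t₁ < t₂)
    (hγ : γ ∈ Set.Icc t₁ t₂) :
    ‖deriv riemannZeta (1 / 2 + γ * I) -
        (riemannZeta (1 / 2 + t₂ * I) - riemannZeta (1 / 2 + t₁ * I)) / ((t₂ - t₁ : ℝ) * I)‖ ≤
      (t₂ - t₁) * (4 * (t₂ + 4) ^ 3) := by
  set φ : ℝ → ℂ := fun t ↦ riemannZeta (1 / 2 + t * I) with hφ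
  set ψ : ℝ → ℂ := fun t ↦ deriv riemannZeta (1 / 2 + t * I) with hψ
  have hne1 : ∀ t : ℝ, t₁ ≤ t → (1 / 2 : ℂ) + t * I ≠ 1 := fun t ht h ↦ by
    have := congrArg Complex.im h; simp at this; linarith
  -- `φ' = I ψ`
  have hderφ : ∀ t ∈ Set.Icc t₁ t₂, HasDerivAt φ (I * ψ t) t := by
    intro t ht
    have hz := (differentiableAt_riemannZeta (hne1 t ht.1)).hasDerivAt
    have hl : HasDerivAt (fun t : ℝ ↦ (1 / 2 : ℂ) + t * I) I t := by
      have := ((hasDerivAt_id (t : ℂ)).mul_const I).const_add (1 / 2 : ℂ)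
      simpa using this.comp_ofReal
    have h := hz.comp t hl
    have h' : HasDerivAt (fun t : ℝ ↦ riemannZeta (1 / 2 + t * I))
        (I * deriv riemannZeta (1 / 2 + t * I)) t := by
      rw [mul_comm]; exact h
    exact h'
  have hcontψ : ContinuousOn ψ (Set.Icc t₁ t₂) := by
    intro t ht
    have ha : AnalyticAt ℂ riemannZeta (1 / 2 + t * I) := analyticOn_riemannZeta _ (hne1 t ht.1)
    have hc : ContinuousAt (deriv riemannZeta) (1 / 2 + t * I) := ha.deriv.continuousAt
    have hl : Continuous fun t : ℝ ↦ (1 / 2 : ℂ) + t * I := by fun_prop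
    exact (hc.comp (f := fun t : ℝ ↦ (1 / 2 : ℂ) + t * I) hl.continuousAt).continuousWithinAt
  -- FTC
  have hFTC : φ t₂ - φ t₁ = ∫ t in t₁..t₂, I * ψ t := by
    rw [intervalIntegral.integral_eq_sub_of_hasDerivAt (fun t ht ↦ hderφ t (by
        rw [Set.uIcc_of_le h12.le] at ht; exact ht))]
    exact ((continuousOn_const.mul hcontψ).intervalIntegrable_of_Icc h12.le)
  -- `ψ` varies little on the segment
  have hlip : ∀ t ∈ Set.Icc t₁ t₂, ‖ψ t - ψ γ‖ ≤ |t - γ| * (4 * (t₂ + 4) ^ 3) := by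
    intro t ht
    -- mean value inequality for `deriv ζ` along the vertical segment
    have hseg : ∀ u ∈ segment ℝ ((1 / 2 : ℂ) + γ * I) (1 / 2 + t * I),
        ‖deriv (deriv riemannZeta) u‖ ≤ 4 * (t₂ + 4) ^ 3 := by
      intro u hu
      rw [segment_eq_image_lineMap] at hu
      obtain ⟨θ, hθ, rfl⟩ := hu
      simp only [AffineMap.lineMap_apply_module]
      set u : ℂ := (1 - θ) • ((1 / 2 : ℂ) + γ * I) + θ • (1 / 2 + t * I) with hu
      have hure : u.re = 1 / 2 := by
        simp [hu]; ring
      have huim : u.im = (1 - θ) * γ + θ * t := by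
        simp [hu]
      have huim2 : 2 ≤ u.im := by
        rw [huim]; nlinarith [hθ.1, hθ.2, hγ.1, ht.1]
      have huimle : u.im ≤ t₂ := by
        rw [huim]; nlinarith [hθ.1, hθ.2, hγ.2, ht.2]
      have hb := norm_deriv2_riemannZeta_le (le_of_eq hure.symm) huim2
      refine hb.trans ?_
      have : ‖u‖ ≤ |u.re| + |u.im| := Complex.norm_le_abs_re_add_abs_im u
      rw [hure, abs_of_nonneg (by linarith : (0 : ℝ) ≤ u.im)] at this
      norm_num at this
      have hle : ‖u‖ + 3 ≤ t₂ + 4 := by linarith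
      have h0 : 0 ≤ ‖u‖ + 3 := by positivity
      exact mul_le_mul_of_nonneg_left (pow_le_pow_left₀ h0 hle 3) (by norm_num)
    have hdd : ∀ u ∈ segment ℝ ((1 / 2 : ℂ) + γ * I) (1 / 2 + t * I),
        DifferentiableAt ℂ (deriv riemannZeta) u := by
      intro u hu
      rw [segment_eq_image_lineMap] at hu
      obtain ⟨θ, hθ, rfl⟩ := hu
      refine ((analyticOn_riemannZeta _ ?_).deriv).differentiableAt
      intro h1
      have := congrArg Complex.im h1
      simp [AffineMap.lineMap_apply_module] at this
      nlinarith [hθ.1, hθ.2, hγ.1, ht.1]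
    have := (convex_segment ((1 / 2 : ℂ) + γ * I) (1 / 2 + t * I)).norm_image_sub_le_of_norm_deriv_le
      (f := deriv riemannZeta) (fun u hu ↦ hdd u hu) hseg
      (left_mem_segment _ _ _) (right_mem_segment _ _ _)
    change ‖deriv riemannZeta (1 / 2 + t * I) - deriv riemannZeta (1 / 2 + γ * I)‖ ≤ _
    refine this.trans (le_of_eq ?_)
    rw [show (1 / 2 : ℂ) + t * I - (1 / 2 + γ * I) = ((t - γ : ℝ)) * I by push_cast; ring,
      norm_mul, Complex.norm_I, mul_one, Complex.norm_real, Real.norm_eq_abs, mul_comm]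
  -- conclude
  have hpos : 0 < t₂ - t₁ := by linarith
  have hkey : deriv riemannZeta (1 / 2 + γ * I) - (φ t₂ - φ t₁) / ((t₂ - t₁ : ℝ) * I) =
      -((∫ t in t₁..t₂, (ψ t - ψ γ)) / (t₂ - t₁ : ℝ)) := by
    rw [hFTC, intervalIntegral.integral_const_mul, intervalIntegral.integral_sub
      (hcontψ.intervalIntegrable_of_Icc h12.le) intervalIntegrable_const,
      intervalIntegral.integral_const, Complex.real_smul]
    have hI : ((t₂ - t₁ : ℝ) : ℂ) * I ≠ 0 := by
      apply mul_ne_zero _ I_ne_zero; exact_mod_cast hpos.ne'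
    have hr : ((t₂ - t₁ : ℝ) : ℂ) ≠ 0 := by exact_mod_cast hpos.ne'
    simp only [hψ]
    field_simp
    push_cast
    ring
  rw [hkey, norm_neg, norm_div, Complex.norm_real, Real.norm_eq_abs, abs_of_pos hpos,
    div_le_iff₀ hpos]
  have hbound : ‖∫ t in t₁..t₂, (ψ t - ψ γ)‖ ≤ (t₂ - t₁) * (4 * (t₂ + 4) ^ 3) * |t₂ - t₁| := by
    refine intervalIntegral.norm_integral_le_of_norm_le_const fun t ht ↦ ?_
    rw [Set.uIoc_of_le h12.le] at ht
    have ht' : t ∈ Set.Icc t₁ t₂ := ⟨ht.1.le, ht.2⟩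
    refine (hlip t ht').trans ?_
    have : |t - γ| ≤ t₂ - t₁ := by
      rw [abs_le]; constructor <;> linarith [hγ.1, hγ.2, ht.1, ht.2]
    have h4 : 0 ≤ 4 * (t₂ + 4) ^ 3 := by
      have : 0 ≤ t₂ + 4 := by linarith [hγ.1, hγ.2]
      positivity
    nlinarith
  rw [abs_of_pos hpos] at hbound
  linarith

end Literature.NumberTheory.LFunctions

end
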